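import Summits.Ventures.DiscreteObjects.Hadamard.CycleParityProjector
import Summits.Ventures.DiscreteObjects.Hadamard.ConferenceGraph333OddFixedPoints
import Summits.Ventures.DiscreteObjects.Hadamard.ConferenceGraph333OrbitBound

/-!
# Cycle-type parity for automorphisms of srg(333,166,82,83): every orbit length `> 1` occurs an even number of times

Framing: lottery ticket; floor = certified bounds/negative ranges.  Cell pub-namedobj (venture DiscreteObjects),
target (H) = `H(668)`, hadamard gen 29.  The full Galois refinement of the gen-28 automorphism census of
`srg(333,166,82,83)` ⇔ symmetric `C(334)` (⇒ `H(668)`): for an adjacency-preserving `σ` with `σ^n = 1` and `37 ∤ n`,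
ALL twisted traces `Σ_x S_{x,σ^k x}` vanish (`ConferenceGraph333OddFixedPoints`), so by the projector argument of
`CycleParityProjector` (the `√333`-eigenspace `E₊` of the Seidel matrix is a `⟨σ⟩`-representation with character
`(#Fix σ^k − 1)/2`, and eigenvalue multiplicities are integers):
* **`aut_even_card_orbits`** — for every `d > 1` the number of `⟨σ⟩`-orbits of length divisible by `d` is EVEN;
  equivalently every orbit length `L > 1` occurs an even number of times in the cycle type of `σ`;
* **`two_mul_dvd_card_period_dvd`** (general counting) ⇒ **`aut_cycle_length_census`** — with `c_L = #{x : period L}`: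
  `Σ_{L ∣ n} c_L = 333`, `#Fix(σ^m) = Σ_{L ∣ m} c_L`, `2d ∣ Σ_{d ∣ L} c_L` for every `d > 1`, and the ORBIT BOUND
  `c_L = 0 ∨ L·(#Fix σ + 1) ≤ 333` (`ConferenceGraph333OrbitBound`), and pointwise `2L ∣ c_L` (`L > 1`, downward induction
  over the divisors: `two_mul_dvd_of_divisor_sums`) — an omega-ready census kit;
* omega-ready corollaries: **`aut_order4_census`** (`σ⁴ = 1`: `f ≡ 1 (mod 4)` AND `#Fix σ² ≡ 5 (mod 8)` — gen 28 had
  only `#Fix σ² ≡ 2f + 3 (mod 8)`), **`aut_order8_census`** (`#Fix σ⁴ ≡ 13 (mod 16)`), **`aut_order6_census`**,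
  **`aut_order10_census`** (`σ^{2p} = 1`: `4 ∣ #Fix σ² − f`, `4p ∣ 333 + f − #Fix σ² − #Fix σ^p`), **`aut_order9_census`**
  (`18 ∣ 333 − #Fix σ³`, `6 ∣ #Fix σ³ − f`).  Order exclusions built on the kit: `ConferenceGraph333GroupCensus`.
For prime order `p` this is gen 28/29's `m` even (`f ≡ 333 (mod 2p)`); the law FAILS for `37 ∣ n` (order `37`: nine
`37`-orbits, `C334Orbit37Matrix`).  WORDS: structure of a HYPOTHETICAL object; nothing constructed or excluded about
`H(668)`.  Ours (PROVISIONAL).  No `sorry`, no new definitions.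
-/

namespace Summit.Ventures.DiscreteObjects.Hadamard

open Finset

/-! ## §1 Counting: from orbit parities to point counts -/

section counting
variable {V : Type*} [Fintype V] [DecidableEq V]

/-- `#Fix(τ^k) = #{x : minimalPeriod τ x ∣ k}`. -/
theorem card_fixed_pow_eq_card_period_dvd (τ : Equiv.Perm V) (k : ℕ) :
    (univ.filter fun x => (τ ^ k) x = x).card = (univ.filter fun x => Function.minimalPeriod τ x ∣ k).card := by
  congr 1
  ext x
  simp only [mem_filter, mem_univ, true_and]
  rw [← Equiv.Perm.iterate_eq_pow]
  exact Function.isPeriodicPt_iff_minimalPeriod_dvd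

/-- **From orbits to points.**  If for every `d' > 1` the number of `⟨τ⟩`-orbits of size divisible by `d'` is even,
then `2d ∣ #{x : d ∣ period(x)}` for every `d > 1` (the orbits of size `≡ d (mod 2d)` are `N_d − N_{2d}` in number). -/
theorem two_mul_dvd_card_period_dvd (τ : Equiv.Perm V) {d : ℕ} (hd : 1 < d)
    (hN : ∀ d', 1 < d' → Even ((((univ : Finset V).image fun x => univ.filter fun y => τ.SameCycle x y).filter
      fun O => d' ∣ O.card).card)) :
    2 * d ∣ (univ.filter fun x => d ∣ Function.minimalPeriod τ x).card := by
  have hNd := hN d hd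
  have hN2d := hN (2 * d) (by omega)
  set L : V → ℕ := fun x => Function.minimalPeriod τ x with hL_def
  set orb : V → Finset V := fun x => univ.filter fun y => τ.SameCycle x y with horb_def
  set Od : Finset (Finset V) := ((univ : Finset V).image orb).filter fun O => d ∣ O.card with hOd_def
  set O2d : Finset (Finset V) := ((univ : Finset V).image orb).filter fun O => 2 * d ∣ O.card with hO2d_def
  have hd0 : 0 < d := by omega
  have hcard : ∀ x, (orb x).card = L x := fun x => by
    simp only [horb_def]
    rw [sameCycle_filter_eq_image τ x, Finset.card_image_of_injOn (perm_pow_injOn_range τ x), Finset.card_range]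
  have horb_mem : ∀ x y, y ∈ orb x → orb y = orb x := by
    intro x y h
    simp only [horb_def, Finset.mem_filter, Finset.mem_univ, true_and] at h
    ext z
    simp only [horb_def, Finset.mem_filter, Finset.mem_univ, true_and]
    exact ⟨fun hz => h.trans hz, fun hz => h.symm.trans hz⟩
  have horb_self : ∀ x, x ∈ orb x := fun x => by simp [horb_def, Equiv.Perm.SameCycle.refl]
  -- step 1: #{x : d ∣ L x} = Σ_{O ∈ Od} |O|
  have h1 : (univ.filter fun x => d ∣ L x).card = ∑ O ∈ Od, O.card := by
    rw [Finset.card_eq_sum_card_fiberwise (f := orb) (s := univ.filter fun x => d ∣ L x)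
      (t := (univ : Finset V).image orb) (fun x _ => Finset.mem_image_of_mem orb (Finset.mem_univ x)),
      hOd_def, Finset.sum_filter]
    refine Finset.sum_congr rfl fun O hO => ?_
    obtain ⟨x₀, -, rfl⟩ := Finset.mem_image.mp hO
    rw [Finset.filter_filter]
    by_cases h : d ∣ (orb x₀).card
    · rw [if_pos h]
      congr 1
      ext y
      simp only [Finset.mem_filter, Finset.mem_univ, true_and]
      constructor
      · rintro ⟨-, hy⟩
        exact hy ▸ horb_self y
      · intro hy
        have e := horb_mem x₀ y hy
        have e' : L y = (orb x₀).card := by rw [← hcard, e]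
        exact ⟨by rw [e']; exact h, e⟩
    · rw [if_neg h, Finset.card_eq_zero, Finset.filter_eq_empty_iff]
      rintro y - ⟨hdy, hy⟩
      apply h
      rw [← hy, hcard]
      exact hdy
  -- step 2: each |O| with O ∈ Od is d·t; the t's with t odd are #Od − #O2d in number
  have h2 : ∑ O ∈ Od, O.card = d * ∑ O ∈ Od, O.card / d := by
    rw [Finset.mul_sum]
    refine Finset.sum_congr rfl fun O hO => ?_
    exact (Nat.mul_div_cancel' (Finset.mem_filter.mp hO).2).symm
  have hsub : Od.filter (fun O => 2 * d ∣ O.card) = O2d := by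
    rw [hOd_def, hO2d_def, Finset.filter_filter]
    congr 1
    ext O
    exact ⟨fun h => h.2, fun h => ⟨(dvd_mul_left d 2).trans h, h⟩⟩
  have h3 : (∑ O ∈ Od, O.card / d) % 2 = 0 := by
    rw [Finset.sum_nat_mod, ← Finset.sum_filter_add_sum_filter_not Od (fun O => 2 * d ∣ O.card)]
    have e1 : ∀ O ∈ Od.filter (fun O => 2 * d ∣ O.card), O.card / d % 2 = 0 := by
      intro O hO
      obtain ⟨-, t, ht⟩ := Finset.mem_filter.mp hO
      rw [ht, mul_comm 2 d, mul_assoc, Nat.mul_div_cancel_left _ hd0]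
      omega
    have e2 : ∀ O ∈ Od.filter (fun O => ¬ 2 * d ∣ O.card), O.card / d % 2 = 1 := by
      intro O hO
      obtain ⟨hO1, hO2⟩ := Finset.mem_filter.mp hO
      obtain ⟨t, ht⟩ := (Finset.mem_filter.mp hO1).2
      rw [ht, Nat.mul_div_cancel_left _ hd0]
      by_contra hne
      apply hO2
      rw [ht]
      obtain ⟨u, hu⟩ : 2 ∣ t := Nat.dvd_of_mod_eq_zero (by omega)
      exact ⟨u, by rw [hu]; ring⟩
    rw [Finset.sum_congr rfl e1, Finset.sum_congr rfl e2, Finset.sum_const_zero, zero_add, Finset.sum_const,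
      smul_eq_mul, mul_one]
    have hsplit := Finset.card_filter_add_card_filter_not (s := Od) (fun O => 2 * d ∣ O.card)
    rw [hsub] at hsplit
    obtain ⟨r1, hr1⟩ := hNd
    obtain ⟨r2, hr2⟩ := hN2d
    omega
  rw [h1, h2]
  obtain ⟨u, hu⟩ : 2 ∣ ∑ O ∈ Od, O.card / d := Nat.dvd_of_mod_eq_zero h3
  exact ⟨u, by rw [hu]; ring⟩

/-- From the divisor-sum form `2d ∣ Σ_{d ∣ L ∣ n} c_L` (all `d > 1`) to the pointwise form `2M ∣ c_M` (`1 < M ∣ n`), by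
downward induction over the divisors of `n`. -/
theorem two_mul_dvd_of_divisor_sums {n : ℕ} (hn : 0 < n) (c : ℕ → ℕ)
    (hS : ∀ d, 1 < d → 2 * d ∣ ∑ L ∈ n.divisors with d ∣ L, c L) : ∀ M, 1 < M → M ∣ n → 2 * M ∣ c M := by
  suffices h : ∀ k M, n / M = k → 1 < M → M ∣ n → 2 * M ∣ c M from fun M h1 h2 => h _ M rfl h1 h2
  intro k
  induction k using Nat.strong_induction_on with
  | _ k ih =>
    intro M hk hM hMn
    have hsum := hS M hM
    have hMmem : M ∈ n.divisors.filter (fun L => M ∣ L) := by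
      simp [Nat.mem_divisors, hMn, hn.ne']
    rw [← Finset.add_sum_erase _ _ hMmem] at hsum
    have hrest : 2 * M ∣ ∑ L ∈ (n.divisors.filter (fun L => M ∣ L)).erase M, c L := by
      apply Finset.dvd_sum
      intro L hL
      rw [Finset.mem_erase, Finset.mem_filter, Nat.mem_divisors] at hL
      obtain ⟨hLM, ⟨hLn, -⟩, hML⟩ := hL
      have hLpos : 0 < L := Nat.pos_of_dvd_of_pos hLn hn
      have hMltL : M < L := lt_of_le_of_ne (Nat.le_of_dvd hLpos hML) (Ne.symm hLM)
      have hqpos : 0 < n / L := Nat.div_pos (Nat.le_of_dvd hn hLn) hLpos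
      have hlt : n / L < n / M := by
        have h1 : n / L * M < n / L * L := Nat.mul_lt_mul_of_pos_left hMltL hqpos
        rw [Nat.div_mul_cancel hLn] at h1
        conv at h1 => rhs; rw [← Nat.div_mul_cancel hMn]
        exact Nat.lt_of_mul_lt_mul_right h1
      have hL2 := ih (n / L) (hk ▸ hlt) L rfl (by omega) hLn
      exact dvd_trans (mul_dvd_mul_left 2 hML) hL2
    exact (Nat.dvd_add_left hrest).mp hsum

/-- **Cycle-length census from orbit parities** (packaging).  With `c_L = #{x : period(x) = L}` and `τ^n = 1`
(`n > 0`): `Σ_{L ∣ n} c_L = |V|`, `#Fix(τ^m) = Σ_{L ∣ n, L ∣ m} c_L`, and `2d ∣ Σ_{L ∣ n, d ∣ L} c_L` for all `d > 1`. -/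
theorem cycle_length_census_of_even_orbits (τ : Equiv.Perm V) {n : ℕ} (hn : 0 < n) (hτ : τ ^ n = 1)
    (hN : ∀ d', 1 < d' → Even ((((univ : Finset V).image fun x => univ.filter fun y => τ.SameCycle x y).filter
      fun O => d' ∣ O.card).card)) :
    ∃ c : ℕ → ℕ, (∑ L ∈ n.divisors, c L = Fintype.card V) ∧
      (∀ m : ℕ, (univ.filter fun x => (τ ^ m) x = x).card = ∑ L ∈ n.divisors with L ∣ m, c L) ∧
      (∀ d : ℕ, 1 < d → 2 * d ∣ ∑ L ∈ n.divisors with d ∣ L, c L) ∧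
      (∀ M : ℕ, c M ≠ 0 → ∃ x, Function.minimalPeriod τ x = M) ∧
      (∀ M : ℕ, 1 < M → 2 * M ∣ c M) := by
  set L : V → ℕ := fun x => Function.minimalPeriod τ x with hL_def
  have hLdvd : ∀ x, L x ∣ n := fun x => by
    refine Function.IsPeriodicPt.minimalPeriod_dvd ?_
    show (τ : V → V)^[n] x = x
    rw [Equiv.Perm.iterate_eq_pow, hτ, Equiv.Perm.one_apply]
  have hLmem : ∀ x, L x ∈ n.divisors := fun x => Nat.mem_divisors.mpr ⟨hLdvd x, hn.ne'⟩
  -- fibrewise counting of any period-defined set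
  have hfib : ∀ (P : ℕ → Prop) [DecidablePred P],
      (univ.filter fun x => P (L x)).card = ∑ k ∈ n.divisors with P k, (univ.filter fun x => L x = k).card := by
    intro P _
    rw [Finset.card_eq_sum_card_fiberwise (f := L) (s := univ.filter fun x => P (L x)) (t := n.divisors)
      (fun x _ => hLmem x), Finset.sum_filter]
    refine Finset.sum_congr rfl fun k _ => ?_
    rw [Finset.filter_filter]
    by_cases hk : P k
    · rw [if_pos hk]
      congr 1
      ext x
      simp only [Finset.mem_filter, Finset.mem_univ, true_and]
      exact ⟨fun h => h.2, fun h => ⟨h ▸ hk, h⟩⟩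
    · rw [if_neg hk, Finset.card_eq_zero, Finset.filter_eq_empty_iff]
      rintro x - ⟨hx, rfl⟩
      exact hk hx
  have hS1 : ∀ d : ℕ, 1 < d → 2 * d ∣ ∑ k ∈ n.divisors with d ∣ k, (univ.filter fun x => L x = k).card := by
    intro d hd
    rw [← hfib (fun k => d ∣ k)]
    exact two_mul_dvd_card_period_dvd τ hd hN
  refine ⟨fun k => (univ.filter fun x => L x = k).card, ?_, fun m => ?_, hS1, fun M hM => ?_, fun M hM => ?_⟩
  · have h := hfib (fun _ => True)
    rw [Finset.filter_true_of_mem (fun _ _ => trivial), Finset.filter_true_of_mem (fun _ _ => trivial),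
      Finset.card_univ] at h
    exact h.symm
  · rw [card_fixed_pow_eq_card_period_dvd, hfib (fun k => k ∣ m)]
  · obtain ⟨x, hx⟩ := Finset.card_pos.mp (Nat.pos_of_ne_zero hM)
    exact ⟨x, (Finset.mem_filter.mp hx).2⟩
  · by_cases hMn : M ∣ n
    · exact two_mul_dvd_of_divisor_sums hn _ hS1 M hM hMn
    · have : (univ.filter fun x => L x = M).card = 0 := by
        rw [Finset.card_eq_zero, Finset.filter_eq_empty_iff]
        rintro x - rfl
        exact hMn (hLdvd x)
      simp only [this, dvd_zero]

end counting

/-! ## §2 The srg -/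

section srg
variable {V : Type*} [Fintype V] [DecidableEq V]

omit [Fintype V] [DecidableEq V] in
/-- powers of an adjacency-preserving permutation preserve adjacency -/
theorem adj_pow_invariant (A : Matrix V V ℤ) (σ : Equiv.Perm V) (hA : ∀ x y, A (σ x) (σ y) = A x y) :
    ∀ (k : ℕ) x y, A ((σ ^ k) x) ((σ ^ k) y) = A x y := by
  intro k; induction k with
  | zero => intro x y; simp
  | succ k ih => intro x y; rw [pow_succ', Equiv.Perm.mul_apply, Equiv.Perm.mul_apply, hA, ih]

/-- **Cycle-type parity.**  For an adjacency-preserving permutation `σ` of an `srg(333,166,82,83)` with `σ^n = 1`,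
`37 ∤ n`, and every `d > 1`: the number of `⟨σ⟩`-orbits whose length is divisible by `d` is EVEN (so every orbit
length `L > 1` occurs an even number of times). -/
theorem aut_even_card_orbits (hV : Fintype.card V = 333) (A : Matrix V V ℤ)
    (h01 : ∀ x y, A x y = 0 ∨ A x y = 1) (hsymm : ∀ x y, A y x = A x y) (hdiag : ∀ x, A x x = 0)
    (hk : ∀ x, ∑ y, A x y = 166) (hsrg : ∀ x y, ∑ z, A x z * A z y = 83 * (1 + (if x = y then 1 else 0)) - A x y)
    (σ : Equiv.Perm V) {n : ℕ} (hσ : σ ^ n = 1) (h37 : ¬ 37 ∣ n) (hA : ∀ x y, A (σ x) (σ y) = A x y)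
    {d : ℕ} (hd : 1 < d) :
    Even ((((univ : Finset V).image fun x => univ.filter fun y => σ.SameCycle x y).filter
      fun O => d ∣ O.card).card) := by
  have hn : 0 < n := Nat.pos_of_ne_zero fun h => h37 (h ▸ dvd_zero 37)
  obtain ⟨-, -, hSs, hS1, hSS⟩ := seidel_identities_of_conferenceGraph A h01 hsymm hdiag 83
    (by rw [hV]; norm_num) (fun x => by rw [hk x]; norm_num) hsrg
  have hAk := adj_pow_invariant A σ hA
  refine even_card_orbits_of_twisted_traces σ hn hσ (fun x y => 1 - (if x = y then 1 else 0) - 2 * A x y)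
    (fun x y => by simp only [hA, σ.injective.eq_iff]) (fun x y => hSs x y) (fun x => hS1 x) (fun x y => hSS x y)
    (fun k => ?_) hd
  have hk' : (σ ^ k) ^ n = 1 := by rw [← pow_mul, mul_comm, pow_mul, hσ, one_pow]
  exact aut_twisted_trace_zero hV A h01 hsymm hdiag hk hsrg (σ ^ k) hk' h37 (hAk k)

/-- **Cycle-length census** for `σ^n = 1`, `37 ∤ n`: there are `c_L = #{x : period L}` with `Σ_{L ∣ n} c_L = 333`,
`#Fix(σ^m) = Σ_{L ∣ n, L ∣ m} c_L`, and `2d ∣ Σ_{L ∣ n, d ∣ L} c_L` for every `d > 1`. -/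
theorem aut_cycle_length_census (hV : Fintype.card V = 333) (A : Matrix V V ℤ)
    (h01 : ∀ x y, A x y = 0 ∨ A x y = 1) (hsymm : ∀ x y, A y x = A x y) (hdiag : ∀ x, A x x = 0)
    (hk : ∀ x, ∑ y, A x y = 166) (hsrg : ∀ x y, ∑ z, A x z * A z y = 83 * (1 + (if x = y then 1 else 0)) - A x y)
    (σ : Equiv.Perm V) {n : ℕ} (hσ : σ ^ n = 1) (h37 : ¬ 37 ∣ n) (hA : ∀ x y, A (σ x) (σ y) = A x y) :
    ∃ c : ℕ → ℕ, (∑ L ∈ n.divisors, c L = 333) ∧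
      (∀ m : ℕ, (univ.filter fun x => (σ ^ m) x = x).card = ∑ L ∈ n.divisors with L ∣ m, c L) ∧
      (∀ d : ℕ, 1 < d → 2 * d ∣ ∑ L ∈ n.divisors with d ∣ L, c L) ∧
      (∀ M : ℕ, 2 ≤ M → c M = 0 ∨ M * ((univ.filter fun y => σ y = y).card + 1) ≤ 333) ∧
      (∀ M : ℕ, 1 < M → 2 * M ∣ c M) := by
  have hn : 0 < n := Nat.pos_of_ne_zero fun h => h37 (h ▸ dvd_zero 37)
  obtain ⟨c, h1, h2, h3, h4, h5⟩ := cycle_length_census_of_even_orbits σ hn hσ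
    (fun d' hd' => aut_even_card_orbits hV A h01 hsymm hdiag hk hsrg σ hσ h37 hA hd')
  refine ⟨c, hV ▸ h1, h2, h3, fun M hM => ?_, h5⟩
  by_cases hc : c M = 0
  · exact Or.inl hc
  · obtain ⟨x, hx⟩ := h4 M hc
    refine Or.inr ?_
    have := aut_orbit_length_bound hV A h01 hsymm hdiag hk hsrg σ hA x (by rw [hx]; exact hM)
    rwa [hx] at this

/-- **Order 4.**  `σ⁴ = 1` adjacency-preserving: `#Fix σ ≡ 1 (mod 4)` and `#Fix σ² ≡ 5 (mod 8)` (numbers of `2`- and of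
`4`-orbits both even). -/
theorem aut_order4_census (hV : Fintype.card V = 333) (A : Matrix V V ℤ)
    (h01 : ∀ x y, A x y = 0 ∨ A x y = 1) (hsymm : ∀ x y, A y x = A x y) (hdiag : ∀ x, A x x = 0)
    (hk : ∀ x, ∑ y, A x y = 166) (hsrg : ∀ x y, ∑ z, A x z * A z y = 83 * (1 + (if x = y then 1 else 0)) - A x y)
    (σ : Equiv.Perm V) (hσ : σ ^ 4 = 1) (hA : ∀ x y, A (σ x) (σ y) = A x y) :
    (univ.filter fun x => σ x = x).card % 4 = 1 ∧ (univ.filter fun x => (σ ^ 2) x = x).card % 8 = 5 := by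
  obtain ⟨c, h1, h2, h3, -, -⟩ := aut_cycle_length_census hV A h01 hsymm hdiag hk hsrg σ hσ (by norm_num) hA
  have hD : Nat.divisors 4 = {1, 2, 4} := by decide
  have f1 := h2 1
  have f2 := h2 2
  have d2 := h3 2 (by norm_num)
  have d4 := h3 4 (by norm_num)
  rw [pow_one] at f1
  simp only [hD, Finset.sum_filter] at h1 f1 f2 d2 d4
  norm_num at h1 f1 f2 d2 d4
  omega

/-- **Order 8.**  `σ⁸ = 1`: `#Fix σ ≡ 1 (mod 4)`, `#Fix σ² ≡ 5 (mod 8)`, `#Fix σ⁴ ≡ 13 (mod 16)`. -/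
theorem aut_order8_census (hV : Fintype.card V = 333) (A : Matrix V V ℤ)
    (h01 : ∀ x y, A x y = 0 ∨ A x y = 1) (hsymm : ∀ x y, A y x = A x y) (hdiag : ∀ x, A x x = 0)
    (hk : ∀ x, ∑ y, A x y = 166) (hsrg : ∀ x y, ∑ z, A x z * A z y = 83 * (1 + (if x = y then 1 else 0)) - A x y)
    (σ : Equiv.Perm V) (hσ : σ ^ 8 = 1) (hA : ∀ x y, A (σ x) (σ y) = A x y) :
    (univ.filter fun x => σ x = x).card % 4 = 1 ∧ (univ.filter fun x => (σ ^ 2) x = x).card % 8 = 5 ∧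
      (univ.filter fun x => (σ ^ 4) x = x).card % 16 = 13 := by
  obtain ⟨c, h1, h2, h3, -, -⟩ := aut_cycle_length_census hV A h01 hsymm hdiag hk hsrg σ hσ (by norm_num) hA
  have hD : Nat.divisors 8 = {1, 2, 4, 8} := by decide
  have f1 := h2 1
  have f2 := h2 2
  have f4 := h2 4
  have d2 := h3 2 (by norm_num)
  have d4 := h3 4 (by norm_num)
  have d8 := h3 8 (by norm_num)
  rw [pow_one] at f1
  simp only [hD, Finset.sum_filter] at h1 f1 f2 f4 d2 d4 d8
  norm_num at h1 f1 f2 f4 d2 d4 d8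
  omega

/-- **Order 6.**  `σ⁶ = 1`: even orbit counts `a₂, a₃, a₆`: `f + 4a₂ + 6a₃ + 12a₆ = 333`, `#Fix σ² = f + 4a₂`,
`#Fix σ³ = f + 6a₃`. -/
theorem aut_order6_census (hV : Fintype.card V = 333) (A : Matrix V V ℤ)
    (h01 : ∀ x y, A x y = 0 ∨ A x y = 1) (hsymm : ∀ x y, A y x = A x y) (hdiag : ∀ x, A x x = 0)
    (hk : ∀ x, ∑ y, A x y = 166) (hsrg : ∀ x y, ∑ z, A x z * A z y = 83 * (1 + (if x = y then 1 else 0)) - A x y)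
    (σ : Equiv.Perm V) (hσ : σ ^ 6 = 1) (hA : ∀ x y, A (σ x) (σ y) = A x y) :
    ∃ a₂ a₃ a₆ : ℕ, (univ.filter fun x => σ x = x).card + 4 * a₂ + 6 * a₃ + 12 * a₆ = 333 ∧
      (univ.filter fun x => (σ ^ 2) x = x).card = (univ.filter fun x => σ x = x).card + 4 * a₂ ∧
      (univ.filter fun x => (σ ^ 3) x = x).card = (univ.filter fun x => σ x = x).card + 6 * a₃ := by
  obtain ⟨c, h1, h2, h3, -, -⟩ := aut_cycle_length_census hV A h01 hsymm hdiag hk hsrg σ hσ (by norm_num) hA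
  have hD : Nat.divisors 6 = {1, 2, 3, 6} := by decide
  have f1 := h2 1
  have f2 := h2 2
  have f3 := h2 3
  have d2 := h3 2 (by norm_num)
  have d3 := h3 3 (by norm_num)
  have d6 := h3 6 (by norm_num)
  rw [pow_one] at f1
  simp only [hD, Finset.sum_filter] at h1 f1 f2 f3 d2 d3 d6
  norm_num at h1 f1 f2 f3 d2 d3 d6
  obtain ⟨u2, hu2⟩ := d2
  obtain ⟨u3, hu3⟩ := d3
  obtain ⟨u6, hu6⟩ := d6
  exact ⟨c 2 / 4, c 3 / 6, c 6 / 12, by omega, by omega, by omega⟩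

/-- **Order 10.**  `σ^10 = 1`: even orbit counts `a₂, a₅, a₁₀`: `f + 4a₂ + 10a₅ + 20a₁₀ = 333`, `#Fix σ² = f + 4a₂`,
`#Fix σ⁵ = f + 10a₅`. -/
theorem aut_order10_census (hV : Fintype.card V = 333) (A : Matrix V V ℤ)
    (h01 : ∀ x y, A x y = 0 ∨ A x y = 1) (hsymm : ∀ x y, A y x = A x y) (hdiag : ∀ x, A x x = 0)
    (hk : ∀ x, ∑ y, A x y = 166) (hsrg : ∀ x y, ∑ z, A x z * A z y = 83 * (1 + (if x = y then 1 else 0)) - A x y)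
    (σ : Equiv.Perm V) (hσ : σ ^ 10 = 1) (hA : ∀ x y, A (σ x) (σ y) = A x y) :
    ∃ a₂ a₅ a₁₀ : ℕ, (univ.filter fun x => σ x = x).card + 4 * a₂ + 10 * a₅ + 20 * a₁₀ = 333 ∧
      (univ.filter fun x => (σ ^ 2) x = x).card = (univ.filter fun x => σ x = x).card + 4 * a₂ ∧
      (univ.filter fun x => (σ ^ 5) x = x).card = (univ.filter fun x => σ x = x).card + 10 * a₅ := by
  obtain ⟨c, h1, h2, h3, -, -⟩ := aut_cycle_length_census hV A h01 hsymm hdiag hk hsrg σ hσ (by norm_num) hA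
  have hD : Nat.divisors 10 = {1, 2, 5, 10} := by decide
  have f1 := h2 1
  have f2 := h2 2
  have f5 := h2 5
  have d2 := h3 2 (by norm_num)
  have d5 := h3 5 (by norm_num)
  have d10 := h3 10 (by norm_num)
  rw [pow_one] at f1
  simp only [hD, Finset.sum_filter] at h1 f1 f2 f5 d2 d5 d10
  norm_num at h1 f1 f2 f5 d2 d5 d10
  obtain ⟨u2, hu2⟩ := d2
  obtain ⟨u5, hu5⟩ := d5
  obtain ⟨u10, hu10⟩ := d10
  exact ⟨c 2 / 4, c 5 / 10, c 10 / 20, by omega, by omega, by omega⟩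

/-- **Order 9.**  `σ⁹ = 1`: even orbit counts `a₃, a₉`: `f + 6a₃ + 18a₉ = 333`, `#Fix σ³ = f + 6a₃`. -/
theorem aut_order9_census (hV : Fintype.card V = 333) (A : Matrix V V ℤ)
    (h01 : ∀ x y, A x y = 0 ∨ A x y = 1) (hsymm : ∀ x y, A y x = A x y) (hdiag : ∀ x, A x x = 0)
    (hk : ∀ x, ∑ y, A x y = 166) (hsrg : ∀ x y, ∑ z, A x z * A z y = 83 * (1 + (if x = y then 1 else 0)) - A x y)
    (σ : Equiv.Perm V) (hσ : σ ^ 9 = 1) (hA : ∀ x y, A (σ x) (σ y) = A x y) :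
    ∃ a₃ a₉ : ℕ, (univ.filter fun x => σ x = x).card + 6 * a₃ + 18 * a₉ = 333 ∧
      (univ.filter fun x => (σ ^ 3) x = x).card = (univ.filter fun x => σ x = x).card + 6 * a₃ := by
  obtain ⟨c, h1, h2, h3, -, -⟩ := aut_cycle_length_census hV A h01 hsymm hdiag hk hsrg σ hσ (by norm_num) hA
  have hD : Nat.divisors 9 = {1, 3, 9} := by decide
  have f1 := h2 1
  have f3 := h2 3
  have d3 := h3 3 (by norm_num)
  have d9 := h3 9 (by norm_num)
  rw [pow_one] at f1
  simp only [hD, Finset.sum_filter] at h1 f1 f3 d3 d9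
  norm_num at h1 f1 f3 d3 d9
  obtain ⟨u3, hu3⟩ := d3
  obtain ⟨u9, hu9⟩ := d9
  exact ⟨c 3 / 6, c 9 / 18, by omega, by omega⟩

end srg

end Summit.Ventures.DiscreteObjects.Hadamard
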